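import Literature.NumberTheory.ModularForms.SiegelCuspStabilizer
import HarnessLib

/-!
# Siegel's volume formula for `Sp₄(ℤ)`: `vol(F) = π³/270` for every Siegel fundamental domain

Stage 5c (assembly) of the bottom-up proof of
`Literature.NumberTheory.ModularForms.Siegel1943_vol_F2` ([cite: Klingen1990, Ch. I §3, closing
remark]: `vol(F₂) = 2 ∏_{k=1}^{2} ξ(2k) = π³/270`). Everything is PROVED (no named facts), by the
theta/Poisson ("Rankin–Selberg") trick instead of Siegel's mean-value limit:

* `ThetaE s p = Σ_{u ∈ ℤ⁴∖0} e^{-π s P_Z[u]}` (`= θ_Z(s) - 1`, `ofReal_siegelTheta_sub_one`), and the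
  functional equation `Θ_{1/2} = 4 Θ_2 + 3` (`ThetaE_half`, from
  `siegelTheta_functional_equation`).
* **Unfolding** (`ThetaE_ae_eq_tsum`, `setLIntegral_ThetaE`): `Σ_{u ≠ 0} = Σ_{k ≥ 1} Σ_{w primitive}`
  (`tsum_ne_zero_eq_tsum_prim`), primitive vectors `= Sp₄(ℤ) e` (`exists_smul_e0_eq`, from
  `exists_sp4Z_mulVec_eq`) with stabiliser `Γ∞` and exact fundamental domain `𝓓∞`
  (`isSiegelFD_DInf`), `P_{γZ}[e] = P_Z[γ⁻¹e]` (`pFormZ_smul`), so that for a.e. `p`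
  `Θ_s(p) = Σ_{γ ∈ Sp₄(ℤ)} Ψ_s(γ p)`, `Ψ_s = 𝟙_{𝓓∞} Σ_k e^{-π s k²/t}`, and
  `∫_F Θ_s = 2 ∫_{H₂} Ψ_s` for every Siegel fundamental domain `F` of `Sp₄(ℤ)`
  (`setLIntegral_tsum_smul_eq`).
* **Evaluation** (`lintegral_PsiE`, `setLIntegral_ThetaE_eq`): by the cusp integral
  `setLIntegral_DInf`, `∫_0^∞ e^{-a/t} t⁻³ dt = a⁻²` (`lintegral_exp_neg_div_mul_inv_cube`) and
  `ζ(4) = π⁴/90` (`hasSum_zeta_four`): `∫_F Θ_s dv = π³/(270 s²)`.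
* **Conclusion** (`siegelVolume_eq_of_isSiegelFD`): `π³/(270/4) = 4 · π³/(270·4) + 3 vol(F)`, hence
  `vol(F) = π³/270` for every Siegel fundamental domain `F` of `Sp₄(ℤ)`. (The conversion to the
  Bochner integral of the fact and `Siegel1943_vol_F2_holds` are in
  `SiegelFundamentalDomainVolumeProofs.lean`, using `SiegelFundamentalDomainTwoReduction.lean`.)

## References

* H. Klingen, *Introductory Lectures on Siegel Modular Forms*, CUP 1990, Ch. I §3. [Klingen1990]
* C. L. Siegel, *Symplectic geometry*, Amer. J. Math. 65 (1943), §§36–39.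
-/

noncomputable section

namespace Literature.NumberTheory.ModularForms.Sp4Covolume

open Complex Matrix

/-! ### `P_Z` on integral vectors and `Θ_s` -/

section Assembly

open MeasureTheory Set Filter
open scoped ENNReal MatrixGroups Topology

variable {x : Fin 6 → ℝ}

/-- `P_Z[u]` for an integral vector `u ∈ ℤ⁴ = ℤ² × ℤ²`. [folklore] -/
def pFormZ (x : Fin 6 → ℝ) (u : Fin 2 ⊕ Fin 2 → ℤ) : ℝ := (pFormS x (fun i => ((u i : ℤ) : ℂ))).re

/-- `pFormZ` agrees with `Sp4Covolume.pForm` through `idx`. [folklore] -/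
theorem pFormZ_eq_pForm (hx : x ∈ U) (u : Fin 2 ⊕ Fin 2 → ℤ) : pFormZ x u = pForm x (idx u) :=
  (pForm_eq_re_pFormS hx u).symm

/-- **Transformation law on integral vectors**: `P_{γ⟨Z⟩}[u] = P_Z[γ⁻¹ u]`. [folklore] -/
theorem pFormZ_smul (γ : Sp4Z) (p : U) (u : Fin 2 ⊕ Fin 2 → ℤ) :
    pFormZ (γ • p : U).1 u = pFormZ p.1 (γ⁻¹ • u) := by
  unfold pFormZ
  rw [coe_sp4Z_smul, pFormS_smul (toR γ) p.2, gc_toR_inv_mulVec]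
  rfl

/-- `P_Z` is homogeneous of degree `2`. [folklore] -/
theorem pForm_zsmul (x : Fin 6 → ℝ) (k : ℤ) (v : Fin 4 → ℤ) :
    pForm x (k • v) = (k : ℝ) ^ 2 * pForm x v := by
  simp only [pForm, yInvForm, yForm, Pi.smul_apply, smul_eq_mul, Int.cast_mul]
  ring

/-- `idx` is `ℤ`-linear. [folklore] -/
theorem idx_zsmul (k : ℤ) (u : Fin 2 ⊕ Fin 2 → ℤ) : idx (k • u) = k • idx u := by
  ext i; simp [idx, Equiv.arrowCongr]

/-- Homogeneity: `P_Z[k u] = k² P_Z[u]`. [folklore] -/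
theorem pFormZ_zsmul (hx : x ∈ U) (k : ℤ) (u : Fin 2 ⊕ Fin 2 → ℤ) :
    pFormZ x (k • u) = (k : ℝ) ^ 2 * pFormZ x u := by
  rw [pFormZ_eq_pForm hx, pFormZ_eq_pForm hx, idx_zsmul, pForm_zsmul]

/-- `P_Z[0] = 0`. [folklore] -/
theorem pFormZ_zero (hx : x ∈ U) : pFormZ x 0 = 0 := by
  rw [pFormZ_eq_pForm hx]
  simp [pForm, yInvForm, yForm, idx, Equiv.arrowCongr]

/-- `P_Z[e] = y₁₁ / det Y = 1 / t(x)`. [folklore] -/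
theorem pFormZ_e0 (hx : x ∈ U) : pFormZ x e0 = 1 / tOf x := by
  rw [pFormZ_eq_pForm hx, idx_apply]
  have h3 : x 3 ≠ 0 := hx.1.ne'
  have hD : x 3 * x 5 - x 4 ^ 2 ≠ 0 := by nlinarith [hx.2]
  simp [pForm, yInvForm, yForm, detY, e0, tOf]

/-- `P_Z ≥ 0`. [folklore] -/
theorem pFormZ_nonneg (hx : x ∈ U) (u : Fin 2 ⊕ Fin 2 → ℤ) : 0 ≤ pFormZ x u := by
  rw [pFormZ_eq_pForm hx]
  have h := kappa_mul_le_pForm hx (idx u)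
  have hk : 0 < kappa x := kappa_pos hx
  nlinarith [sq_nonneg ((idx u 0 : ℝ)), sq_nonneg ((idx u 1 : ℝ)), sq_nonneg ((idx u 2 : ℝ)),
    sq_nonneg ((idx u 3 : ℝ))]

/-- **`Θ_s` as an `ℝ≥0∞`-valued function**: `Σ_{u ≠ 0} e^{-π s P_Z[u]}`. [folklore] -/
def ThetaE (s : ℝ) (p : U) : ℝ≥0∞ :=
  ∑' u : {u : Fin 2 ⊕ Fin 2 → ℤ // u ≠ 0}, ENNReal.ofReal (Real.exp (-Real.pi * s * pFormZ p.1 u))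

/-- `θ_Z(s)` as a sum over `ℤ² × ℤ²`. [folklore] -/
theorem siegelTheta_eq_tsum_pFormZ (hx : x ∈ U) (s : ℝ) :
    siegelTheta x s = ∑' u : Fin 2 ⊕ Fin 2 → ℤ, Real.exp (-Real.pi * s * pFormZ x u) := by
  unfold siegelTheta
  rw [← idx.tsum_eq]
  simp_rw [pFormZ_eq_pForm hx]

/-- Summability of `e^{-π s P_Z[u]}` over `ℤ⁴`. [folklore] -/
theorem summable_exp_pFormZ (hx : x ∈ U) {s : ℝ} (hs : 0 < s) :
    Summable fun u : Fin 2 ⊕ Fin 2 → ℤ => Real.exp (-Real.pi * s * pFormZ x u) := by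
  have h := (summable_exp_pForm hx hs).comp_injective idx.injective
  refine h.congr fun u => ?_
  simp [Function.comp, pFormZ_eq_pForm hx]

/-- `θ_Z(s) - 1 = Σ_{u ≠ 0} e^{-π s P_Z[u]}`. [folklore] -/
theorem siegelTheta_sub_one (hx : x ∈ U) {s : ℝ} (hs : 0 < s) :
    siegelTheta x s - 1 =
      ∑' u : {u : Fin 2 ⊕ Fin 2 → ℤ // u ≠ 0}, Real.exp (-Real.pi * s * pFormZ x u) := by
  rw [siegelTheta_eq_tsum_pFormZ hx, (summable_exp_pFormZ hx hs).tsum_eq_add_tsum_ite 0,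
    pFormZ_zero hx, mul_zero, Real.exp_zero, add_sub_cancel_left]
  change _ = ∑' u : {u : Fin 2 ⊕ Fin 2 → ℤ | u ≠ 0}, Real.exp (-Real.pi * s * pFormZ x u)
  rw [tsum_subtype {u : Fin 2 ⊕ Fin 2 → ℤ | u ≠ 0} (fun u => Real.exp (-Real.pi * s * pFormZ x u))]
  apply tsum_congr
  intro u
  by_cases hu : u = 0
  · subst hu; simp
  · rw [Set.indicator_of_mem (by exact hu)]; simp [hu]

/-- `θ_Z(s) ≥ 1`. [folklore] -/
theorem one_le_siegelTheta (hx : x ∈ U) {s : ℝ} (hs : 0 < s) : 1 ≤ siegelTheta x s := by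
  have h := siegelTheta_sub_one hx hs
  have : 0 ≤ ∑' u : {u : Fin 2 ⊕ Fin 2 → ℤ // u ≠ 0}, Real.exp (-Real.pi * s * pFormZ x u) :=
    tsum_nonneg fun _ => (Real.exp_pos _).le
  linarith

/-- `ofReal (θ_Z(s) - 1) = Θ_s`. [folklore] -/
theorem ofReal_siegelTheta_sub_one (p : U) {s : ℝ} (hs : 0 < s) :
    ENNReal.ofReal (siegelTheta p.1 s - 1) = ThetaE s p := by
  rw [siegelTheta_sub_one p.2 hs, ThetaE,
    ENNReal.ofReal_tsum_of_nonneg (fun _ => (Real.exp_pos _).le)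
      ((summable_exp_pFormZ p.2 hs).subtype _)]

/-- **The functional equation at `s = 2` in `ℝ≥0∞`**: `Θ_{1/2} = 4 Θ_2 + 3`. [folklore] -/
theorem ThetaE_half (p : U) : ThetaE (1 / 2) p = 4 * ThetaE 2 p + 3 := by
  have hfe := siegelTheta_functional_equation p.2 (by norm_num : (0 : ℝ) < 2)
  rw [← ofReal_siegelTheta_sub_one p (by norm_num), ← ofReal_siegelTheta_sub_one p (by norm_num),
    hfe]
  have h1 := one_le_siegelTheta p.2 (by norm_num : (0 : ℝ) < 2)
  rw [show (2 : ℝ) ^ 2 * siegelTheta p.1 2 - 1 = 4 * (siegelTheta p.1 2 - 1) + 3 by ring,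
    ENNReal.ofReal_add (by nlinarith) (by norm_num), ENNReal.ofReal_mul (by norm_num)]
  norm_num

end Assembly

/-! ### primitive vectors as the orbit of `e`, and the coset reindexing -/

section Orbit

open MeasureTheory Set Filter
open scoped ENNReal MatrixGroups Topology

/-- A common divisor of the entries divides `vgcd`. [folklore] -/
theorem dvd_vgcd {d : ℤ} {v : Fin 2 ⊕ Fin 2 → ℤ} (h : ∀ i, d ∣ v i) : d ∣ (vgcd v : ℤ) := by
  unfold vgcd
  apply Int.dvd_coe_gcd <;> apply Int.dvd_coe_gcd <;> exact h _

/-- `vgcd u ∣ vgcd (γ u)`. [folklore] -/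
theorem vgcd_dvd_vgcd_smul (γ : Sp4Z) (u : Fin 2 ⊕ Fin 2 → ℤ) : (vgcd u : ℤ) ∣ (vgcd (γ • u) : ℤ) := by
  apply dvd_vgcd
  intro i
  rw [sp4Z_smul_def, Matrix.mulVec, dotProduct]
  exact Finset.dvd_sum fun j _ => Dvd.dvd.mul_left (vgcd_dvd u j) _

/-- `Sp₄(ℤ)` preserves the gcd of the entries. [folklore] -/
theorem vgcd_smul_eq (γ : Sp4Z) (u : Fin 2 ⊕ Fin 2 → ℤ) : vgcd (γ • u) = vgcd u := by
  apply Nat.dvd_antisymm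
  · have h := vgcd_dvd_vgcd_smul γ⁻¹ (γ • u)
    rw [inv_smul_smul] at h
    exact_mod_cast h
  · exact_mod_cast vgcd_dvd_vgcd_smul γ u

/-- `Sp₄(ℤ)` preserves primitivity. [folklore] -/
theorem smul_mem_Prim (γ : Sp4Z) {w : Fin 2 ⊕ Fin 2 → ℤ} (hw : w ∈ Prim) : γ • w ∈ Prim := by
  simp only [Prim, mem_setOf_eq] at hw ⊢
  rw [vgcd_smul_eq, hw]

/-- `e` is primitive. [folklore] -/
theorem e0_mem_Prim : e0 ∈ Prim := by
  simp [Prim, vgcd, e0]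

/-- **Transitivity** (from `exists_sp4Z_mulVec_eq`): every primitive vector is `γ e`. [folklore] -/
theorem exists_smul_e0_eq {w : Fin 2 ⊕ Fin 2 → ℤ} (hw : w ∈ Prim) : ∃ γ : Sp4Z, γ • e0 = w := by
  have hprim : Int.gcd (Int.gcd (w (Sum.inl 0)) (w (Sum.inr 0)) : ℤ)
      (Int.gcd (w (Sum.inl 1)) (w (Sum.inr 1)) : ℤ) = 1 := hw
  obtain ⟨γ, hγ, hγw⟩ := exists_sp4Z_mulVec_eq (fun i => w (Sum.inl i)) (fun i => w (Sum.inr i)) hprim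
  have hw' : Sum.elim (fun i => w (Sum.inl i)) (fun i => w (Sum.inr i)) = w := by
    ext (i | i) <;> rfl
  rw [hw'] at hγw
  refine ⟨(⟨γ, hγ⟩ : Sp4Z)⁻¹, ?_⟩
  have : (⟨γ, hγ⟩ : Sp4Z) • w = e0 := hγw
  rw [← this, inv_smul_smul]

/-- The orbit map `γ ↦ γ e ∈ Prim`. [folklore] -/
def orbitMap (γ : Sp4Z) : Prim := ⟨γ • e0, smul_mem_Prim γ e0_mem_Prim⟩

/-- The orbit map on vectors. [folklore] -/
@[simp] theorem coe_orbitMap (γ : Sp4Z) : (orbitMap γ : Fin 2 ⊕ Fin 2 → ℤ) = γ • e0 := rfl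

/-- **Reindexing `Sp₄(ℤ)` by the orbit of `e`**: `Σ_γ f(γ) = Σ_{w primitive} Σ_{γ e = w} f(γ)`. [folklore] -/
theorem tsum_sp4Z_eq_tsum_prim (f : Sp4Z → ℝ≥0∞) :
    ∑' γ : Sp4Z, f γ = ∑' w : Prim, ∑' γ : {γ : Sp4Z // orbitMap γ = w}, f γ := by
  rw [← (Equiv.sigmaFiberEquiv orbitMap).tsum_eq, ENNReal.tsum_sigma']
  rfl

/-- The fibre of the orbit map over `w = γ_w e` is the coset `γ_w Γ∞`. [folklore] -/
def fiberEquiv {w : Prim} {γw : Sp4Z} (h : γw • e0 = w) : GammaInf ≃ {γ : Sp4Z // orbitMap γ = w} where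
  toFun η := ⟨γw * η, by
    apply Subtype.ext
    rw [coe_orbitMap, mul_smul, show (η : Sp4Z) • e0 = e0 from η.2, h]⟩
  invFun γ := ⟨γw⁻¹ * γ, by
    show (γw⁻¹ * (γ : Sp4Z)) • e0 = e0
    have hγ : (γ : Sp4Z) • e0 = w := congrArg Subtype.val γ.2
    rw [mul_smul, hγ, ← h, inv_smul_smul]⟩
  left_inv η := by apply Subtype.ext; simp
  right_inv γ := by apply Subtype.ext; simp

/-- Summing over a fibre of the orbit map = summing over `Γ∞`. [folklore] -/
theorem tsum_fiber {w : Prim} {γw : Sp4Z} (h : γw • e0 = w) (g : Sp4Z → ℝ≥0∞) :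
    ∑' γ : {γ : Sp4Z // orbitMap γ = w}, g γ = ∑' η : GammaInf, g (γw * η) := by
  rw [← (fiberEquiv h).tsum_eq]
  rfl

/-- A chosen `γ_w` with `γ_w e = w`. [folklore] -/
def gammaOf (w : Prim) : Sp4Z := Classical.choose (exists_smul_e0_eq w.2)

/-- `γ_w e = w`. [folklore] -/
theorem gammaOf_spec (w : Prim) : gammaOf w • e0 = w := Classical.choose_spec (exists_smul_e0_eq w.2)

/-- Transport of an a.e. property along the measure-preserving action. [folklore] -/
theorem ae_comp_smul {P : U → Prop} (h : ∀ᵐ p ∂siegelVolume, P p) (γ : Sp4Z) :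
    ∀ᵐ p ∂siegelVolume, P (γ • p) := by
  rw [ae_iff] at h ⊢
  have : {p : U | ¬P (γ • p)} = (fun p => γ • p) ⁻¹' {p | ¬P p} := rfl
  rw [this, MeasureTheory.measure_preimage_smul]
  exact h

/-- The primitive vectors form a countable set. [folklore] -/
instance instCountablePrim : Countable Prim := by unfold Prim; infer_instance

/-- **The coset sums are `1` a.e.**: for a.e. `p` and every primitive `w`,
`Σ_{η ∈ Γ∞} 𝟙_{𝓓∞}(η γ_w⁻¹ p) = 1`. [folklore] -/
theorem ae_coset_sum_eq_one :
    ∀ᵐ p ∂siegelVolume, ∀ w : Prim,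
      (∑' η : GammaInf, DInf.indicator (fun _ => (1 : ℝ≥0∞)) ((η : Sp4Z) • ((gammaOf w)⁻¹ • p))) = 1 := by
  rw [ae_all_iff]
  intro w
  exact ae_comp_smul (ae_tsum_indicator_smul_eq_one neg_one_not_mem_GammaInf isSiegelFD_DInf)
    (gammaOf w)⁻¹

/-- **Unfolding the sum over primitive vectors**: for a.e. `p` and every `G`,
`Σ_{w primitive} G(P_p[w]) = Σ_{γ ∈ Sp₄(ℤ)} 𝟙_{𝓓∞}(γ p) G(P_{γ p}[e])`. [folklore] -/
theorem ae_tsum_prim_eq_tsum_sp4Z :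
    ∀ᵐ p ∂siegelVolume, ∀ G : ℝ → ℝ≥0∞,
      ∑' w : Prim, G (pFormZ p.1 w) =
        ∑' γ : Sp4Z, DInf.indicator (fun _ => (1 : ℝ≥0∞)) (γ • p) * G (pFormZ (γ • p : U).1 e0) := by
  filter_upwards [ae_coset_sum_eq_one] with p hp G
  simp_rw [pFormZ_smul]
  rw [← (Equiv.inv Sp4Z).tsum_eq]
  simp only [Equiv.inv_apply, inv_inv]
  rw [tsum_sp4Z_eq_tsum_prim]
  apply tsum_congr
  intro w
  have hfib : ∀ γ : {γ : Sp4Z // orbitMap γ = w},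
      DInf.indicator (fun _ => (1 : ℝ≥0∞)) ((γ : Sp4Z)⁻¹ • p) * G (pFormZ p.1 ((γ : Sp4Z) • e0)) =
      DInf.indicator (fun _ => (1 : ℝ≥0∞)) ((γ : Sp4Z)⁻¹ • p) * G (pFormZ p.1 w) := by
    intro γ
    have : (γ : Sp4Z) • e0 = w := congrArg Subtype.val γ.2
    rw [this]
  rw [tsum_congr hfib, ENNReal.tsum_mul_right,
    tsum_fiber (gammaOf_spec w) (fun γ => DInf.indicator (fun _ => (1 : ℝ≥0∞)) (γ⁻¹ • p))]
  have hre : ∀ η : GammaInf, DInf.indicator (fun _ => (1 : ℝ≥0∞)) ((gammaOf w * (η : Sp4Z))⁻¹ • p) =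
      DInf.indicator (fun _ => (1 : ℝ≥0∞)) (((η⁻¹ : GammaInf) : Sp4Z) • ((gammaOf w)⁻¹ • p)) := by
    intro η
    rw [_root_.mul_inv_rev, mul_smul]; rfl
  rw [tsum_congr hre]
  rw [show (∑' η : GammaInf, DInf.indicator (fun _ => (1 : ℝ≥0∞))
      (((η⁻¹ : GammaInf) : Sp4Z) • ((gammaOf w)⁻¹ • p))) =
      ∑' η : GammaInf, DInf.indicator (fun _ => (1 : ℝ≥0∞)) ((η : Sp4Z) • ((gammaOf w)⁻¹ • p)) from
    (Equiv.inv GammaInf).tsum_eq (fun η : GammaInf =>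
      DInf.indicator (fun _ => (1 : ℝ≥0∞)) ((η : Sp4Z) • ((gammaOf w)⁻¹ • p))), hp w, one_mul]

end Orbit

/-! ### the one-dimensional integral and `ζ(4)` -/

section OneDim

open MeasureTheory Set Filter Real
open scoped ENNReal Topology

/-- **`∫_0^∞ e^{-a/t} t⁻³ dt = 1/a²`** (substitute `u = 1/t`: `∫_0^∞ u e^{-au} du = Γ(2)/a²`). [folklore] -/
theorem lintegral_exp_neg_div_mul_inv_cube {a : ℝ} (ha : 0 < a) :
    ∫⁻ t in Ioi (0 : ℝ), ENNReal.ofReal (Real.exp (-a / t)) * ENNReal.ofReal (t⁻¹ ^ 3) =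
      ENNReal.ofReal (1 / a ^ 2) := by
  -- change of variables `t = u⁻¹`
  have himg : (fun u : ℝ => u⁻¹) '' Ioi (0 : ℝ) = Ioi 0 := by
    ext t
    simp only [mem_image, mem_Ioi]
    constructor
    · rintro ⟨u, hu, rfl⟩; exact inv_pos.2 hu
    · intro ht; exact ⟨t⁻¹, inv_pos.2 ht, inv_inv t⟩
  have hderiv : ∀ u ∈ Ioi (0 : ℝ), HasDerivWithinAt (fun u : ℝ => u⁻¹) (-(u ^ 2)⁻¹) (Ioi 0) u :=
    fun u hu => (hasDerivAt_inv (ne_of_gt hu)).hasDerivWithinAt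
  have hinj : InjOn (fun u : ℝ => u⁻¹) (Ioi 0) := inv_injective.injOn
  rw [← himg, lintegral_image_eq_lintegral_abs_deriv_mul measurableSet_Ioi hderiv hinj]
  have hpt : ∀ u ∈ Ioi (0 : ℝ), ENNReal.ofReal |-(u ^ 2)⁻¹| *
      (ENNReal.ofReal (Real.exp (-a / u⁻¹)) * ENNReal.ofReal (u⁻¹⁻¹ ^ 3)) =
      ENNReal.ofReal (u ^ ((2 : ℝ) - 1) * Real.exp (-(a * u))) := by
    intro u hu
    have hu0 : (0 : ℝ) < u := hu
    rw [abs_neg, abs_of_pos (by positivity), inv_inv, ← ENNReal.ofReal_mul (Real.exp_pos _).le,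
      ← ENNReal.ofReal_mul (by positivity)]
    congr 1
    rw [show (2 : ℝ) - 1 = 1 by norm_num, Real.rpow_one, div_eq_mul_inv, inv_inv, neg_mul]
    field_simp
  rw [setLIntegral_congr_fun measurableSet_Ioi hpt]
  have hint : IntegrableOn (fun u : ℝ => u ^ ((2 : ℝ) - 1) * Real.exp (-(a * u))) (Ioi 0) := by
    have h := integrableOn_rpow_mul_exp_neg_mul_rpow (s := 1) (p := 1) (by norm_num) le_rfl ha
    refine h.congr_fun (fun u hu => ?_) measurableSet_Ioi
    have hu0 : (0 : ℝ) < u := hu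
    simp only [Real.rpow_one, show (2 : ℝ) - 1 = 1 by norm_num, neg_mul]
  rw [← ofReal_integral_eq_lintegral_ofReal hint, Real.integral_rpow_mul_exp_neg_mul_Ioi
    (by norm_num : (0 : ℝ) < 2) ha, Real.Gamma_two, mul_one]
  · congr 1
    rw [show (2 : ℝ) = ((2 : ℕ) : ℝ) by norm_num, Real.rpow_natCast, div_pow, one_pow]
  · filter_upwards [ae_restrict_mem measurableSet_Ioi] with u hu
    have hu0 : (0 : ℝ) < u := hu
    positivity

/-- **`Σ_{n ≥ 1} n⁻⁴ = π⁴/90`** in `ℝ≥0∞`. [folklore] -/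
theorem tsum_inv_succ_pow_four :
    ∑' n : ℕ, ENNReal.ofReal (1 / ((n : ℝ) + 1) ^ 4) = ENNReal.ofReal (Real.pi ^ 4 / 90) := by
  have h : HasSum (fun n : ℕ => 1 / ((n : ℝ) + 1) ^ 4) (Real.pi ^ 4 / 90) := by
    have h4 := hasSum_zeta_four
    have h5 : HasSum (fun n : ℕ => 1 / ((n + 1 : ℕ) : ℝ) ^ 4) (Real.pi ^ 4 / 90) := by
      refine (hasSum_nat_add_iff (f := fun n : ℕ => 1 / (n : ℝ) ^ 4) 1).2 ?_
      simpa using h4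
    simpa [Nat.cast_add, Nat.cast_one] using h5
  rw [← ENNReal.ofReal_tsum_of_nonneg (fun n => by positivity) h.summable, h.tsum_eq]

end OneDim

/-! ### `∫_F Θ_s = π³/(270 s²)` and the covolume -/

section Final

open MeasureTheory Set Filter
open scoped ENNReal MatrixGroups Topology

/-- `e^{-π s r}` in `ℝ≥0∞`. [folklore] -/
def gE (s r : ℝ) : ℝ≥0∞ := ENNReal.ofReal (Real.exp (-Real.pi * s * r))

/-- `gE s` is measurable. [folklore] -/
theorem measurable_gE (s : ℝ) : Measurable (gE s) := by
  unfold gE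
  exact (Real.measurable_exp.comp (measurable_const.mul measurable_id)).ennreal_ofReal

/-- `Ψ_s(p) = 𝟙_{𝓓∞}(p) Σ_{k ≥ 1} e^{-π s k² / t(p)}`. [folklore] -/
def PsiE (s : ℝ) (p : U) : ℝ≥0∞ :=
  DInf.indicator (fun _ => (1 : ℝ≥0∞)) p * ∑' n : ℕ, gE s (((n : ℝ) + 1) ^ 2 / tOf p.1)

/-- `Ψ_s` is measurable. [folklore] -/
theorem measurable_PsiE (s : ℝ) : Measurable (PsiE s) := by
  unfold PsiE
  refine (measurable_const.indicator measurableSet_DInf).mul (Measurable.tsum fun n => ?_)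
  exact (measurable_gE s).comp (measurable_const.div (measurable_tOf.comp measurable_subtype_coe))

/-- **Unfolded form of `Θ_s`**: `Θ_s(p) = Σ_{γ ∈ Sp₄(ℤ)} Ψ_s(γ p)` for a.e. `p`. [folklore] -/
theorem ThetaE_ae_eq_tsum (s : ℝ) :
    ∀ᵐ p ∂siegelVolume, ThetaE s p = ∑' γ : Sp4Z, PsiE s (γ • p) := by
  filter_upwards [ae_tsum_prim_eq_tsum_sp4Z] with p hp
  have hx := p.2
  calc ThetaE s p = ∑' u : {u : Fin 2 ⊕ Fin 2 → ℤ // u ≠ 0}, gE s (pFormZ p.1 u) := rfl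
    _ = ∑' n : ℕ, ∑' w : Prim, gE s (pFormZ p.1 (((n + 1 : ℕ) : ℤ) • (w : Fin 2 ⊕ Fin 2 → ℤ))) :=
        tsum_ne_zero_eq_tsum_prim (fun u => gE s (pFormZ p.1 u))
    _ = ∑' n : ℕ, ∑' w : Prim, gE s (((n : ℝ) + 1) ^ 2 * pFormZ p.1 w) := by
        refine tsum_congr fun n => tsum_congr fun w => ?_
        rw [pFormZ_zsmul hx]; push_cast; ring_nf
    _ = ∑' n : ℕ, ∑' γ : Sp4Z, DInf.indicator (fun _ => (1 : ℝ≥0∞)) (γ • p) *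
          gE s (((n : ℝ) + 1) ^ 2 * pFormZ (γ • p : U).1 e0) :=
        tsum_congr fun n => hp (fun r => gE s (((n : ℝ) + 1) ^ 2 * r))
    _ = ∑' n : ℕ, ∑' γ : Sp4Z, DInf.indicator (fun _ => (1 : ℝ≥0∞)) (γ • p) *
          gE s (((n : ℝ) + 1) ^ 2 / tOf (γ • p : U).1) := by
        refine tsum_congr fun n => tsum_congr fun γ => ?_
        rw [pFormZ_e0 (γ • p).2, mul_one_div]
    _ = ∑' γ : Sp4Z, ∑' n : ℕ, DInf.indicator (fun _ => (1 : ℝ≥0∞)) (γ • p) *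
          gE s (((n : ℝ) + 1) ^ 2 / tOf (γ • p : U).1) := ENNReal.tsum_comm
    _ = ∑' γ : Sp4Z, PsiE s (γ • p) := by
        refine tsum_congr fun γ => ?_
        rw [PsiE, ENNReal.tsum_mul_left]

/-- **Unfolding**: `∫_F Θ_s dv = 2 ∫_{H₂} Ψ_s dv` for a Siegel fundamental domain `F` of `Sp₄(ℤ)`. [folklore] -/
theorem setLIntegral_ThetaE {F : Set U} (hF : IsSiegelFD ⊤ F) (s : ℝ) :
    ∫⁻ p in F, ThetaE s p ∂siegelVolume = 2 * ∫⁻ p, PsiE s p ∂siegelVolume := by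
  have h1 : ∫⁻ p in F, ThetaE s p ∂siegelVolume =
      ∫⁻ p in F, ∑' γ : (⊤ : Subgroup Sp4Z), PsiE s ((γ : Sp4Z) • p) ∂siegelVolume := by
    apply lintegral_congr_ae
    filter_upwards [ae_restrict_of_ae (ThetaE_ae_eq_tsum s)] with p hp
    rw [hp, ← (Subgroup.topEquiv : (⊤ : Subgroup Sp4Z) ≃* Sp4Z).toEquiv.tsum_eq]
    rfl
  rw [h1]
  exact setLIntegral_tsum_smul_eq (Subgroup.mem_top _) hF (measurable_PsiE s).aemeasurable

/-- **`∫_{H₂} Ψ_s dv = π³/(540 s²)`** (cusp integral, `∫_0^∞ e^{-a/t} t⁻³ dt = a⁻²`, `ζ(4) = π⁴/90`). [folklore] -/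
theorem lintegral_PsiE {s : ℝ} (hs : 0 < s) :
    ∫⁻ p, PsiE s p ∂siegelVolume = ENNReal.ofReal (Real.pi ^ 3 / (540 * s ^ 2)) := by
  have hind : ∀ p : U, PsiE s p =
      DInf.indicator (fun p : U => ∑' n : ℕ, gE s (((n : ℝ) + 1) ^ 2 / tOf p.1)) p := by
    intro p
    unfold PsiE
    by_cases hp : p ∈ DInf
    · rw [indicator_of_mem hp, indicator_of_mem hp, one_mul]
    · rw [indicator_of_notMem hp, indicator_of_notMem hp, zero_mul]
  simp_rw [hind]
  rw [lintegral_indicator measurableSet_DInf]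
  have hmeas : ∀ n : ℕ, Measurable fun p : U => gE s (((n : ℝ) + 1) ^ 2 / tOf p.1) := fun n =>
    (measurable_gE s).comp (measurable_const.div (measurable_tOf.comp measurable_subtype_coe))
  rw [lintegral_tsum fun n => (hmeas n).aemeasurable]
  have hn : ∀ n : ℕ, ∫⁻ p in DInf, gE s (((n : ℝ) + 1) ^ 2 / tOf p.1) ∂siegelVolume =
      ENNReal.ofReal (Real.pi / 3) * ENNReal.ofReal (1 / 2) *
        ENNReal.ofReal (1 / (Real.pi * s * ((n : ℝ) + 1) ^ 2) ^ 2) := by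
    intro n
    rw [setLIntegral_DInf (fun t => gE s (((n : ℝ) + 1) ^ 2 / t))
      ((measurable_gE s).comp (measurable_const.div measurable_id))]
    congr 1
    have ha : 0 < Real.pi * s * ((n : ℝ) + 1) ^ 2 := by positivity
    rw [← lintegral_exp_neg_div_mul_inv_cube ha]
    apply setLIntegral_congr_fun measurableSet_Ioi
    intro t _
    simp only [gE]
    congr 3
    ring
  simp_rw [hn]
  rw [ENNReal.tsum_mul_left]
  have hc : ∀ n : ℕ, ENNReal.ofReal (1 / (Real.pi * s * ((n : ℝ) + 1) ^ 2) ^ 2) =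
      ENNReal.ofReal (1 / (Real.pi * s) ^ 2) * ENNReal.ofReal (1 / ((n : ℝ) + 1) ^ 4) := by
    intro n
    rw [← ENNReal.ofReal_mul (by positivity)]
    congr 1
    field_simp
  simp_rw [hc]
  rw [ENNReal.tsum_mul_left, tsum_inv_succ_pow_four, ← ENNReal.ofReal_mul (by positivity),
    ← ENNReal.ofReal_mul (by positivity), ← ENNReal.ofReal_mul (by positivity)]
  congr 1
  field_simp
  ring

/-- **`∫_F Θ_s dv = π³ / (270 s²)`** for every Siegel fundamental domain `F` of `Sp₄(ℤ)` and `s > 0`. [folklore] -/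
theorem setLIntegral_ThetaE_eq {F : Set U} (hF : IsSiegelFD ⊤ F) {s : ℝ} (hs : 0 < s) :
    ∫⁻ p in F, ThetaE s p ∂siegelVolume = ENNReal.ofReal (Real.pi ^ 3 / (270 * s ^ 2)) := by
  rw [setLIntegral_ThetaE hF, lintegral_PsiE hs, show (2 : ℝ≥0∞) = ENNReal.ofReal 2 by simp,
    ← ENNReal.ofReal_mul (by norm_num)]
  congr 1
  field_simp
  ring

/-- `P_Z[v]` is measurable in `Z`. [folklore] -/
theorem measurable_pForm (v : Fin 4 → ℤ) : Measurable fun x : Fin 6 → ℝ => pForm x v := by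
  unfold pForm yInvForm yForm detY
  fun_prop

/-- `Θ_s` is measurable. [folklore] -/
theorem measurable_ThetaE (s : ℝ) : Measurable (ThetaE s) := by
  have h : ThetaE s = fun p : U => ∑' u : {u : Fin 2 ⊕ Fin 2 → ℤ // u ≠ 0},
      ENNReal.ofReal (Real.exp (-Real.pi * s * pForm p.1 (idx u))) := by
    funext p
    unfold ThetaE
    exact tsum_congr fun u => by rw [pFormZ_eq_pForm p.2]
  rw [h]
  refine Measurable.tsum fun u => ?_
  exact (Real.measurable_exp.comp (measurable_const.mul
    ((measurable_pForm _).comp measurable_subtype_coe))).ennreal_ofReal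

/-- **Siegel's volume formula** (`n = 2`): every Siegel fundamental domain of `Sp₄(ℤ)` on `H₂` has
symplectic volume `π³/270 = 2 ζ(2)ζ(4) π⁻³ · …` ; proof by the theta/Poisson trick:
`∫_F Θ_{1/2} = 4 ∫_F Θ_2 + 3 vol(F)` and `∫_F Θ_s = π³/(270 s²)`. [folklore] -/
theorem siegelVolume_eq_of_isSiegelFD {F : Set U} (hF : IsSiegelFD ⊤ F) :
    siegelVolume F = ENNReal.ofReal (Real.pi ^ 3 / 270) := by
  have hhalf := setLIntegral_ThetaE_eq hF (by norm_num : (0 : ℝ) < 1 / 2)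
  have htwo := setLIntegral_ThetaE_eq hF (by norm_num : (0 : ℝ) < 2)
  have hsplit : ∫⁻ p in F, ThetaE (1 / 2) p ∂siegelVolume =
      4 * ∫⁻ p in F, ThetaE 2 p ∂siegelVolume + 3 * siegelVolume F := by
    have : (fun p => ThetaE (1 / 2) p) = fun p => 4 * ThetaE 2 p + 3 := funext ThetaE_half
    rw [this, lintegral_add_right _ measurable_const, lintegral_const_mul _ (measurable_ThetaE 2),
      setLIntegral_const]
  rw [hhalf, htwo] at hsplit
  set c : ℝ := Real.pi ^ 3 / 270 with hc
  have hcpos : 0 ≤ c := by positivity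
  have e1 : Real.pi ^ 3 / (270 * (1 / 2) ^ 2) = 4 * c := by rw [hc]; ring
  have e2 : Real.pi ^ 3 / (270 * 2 ^ 2) = c / 4 := by rw [hc]; ring
  rw [e1, e2] at hsplit
  have h4 : (4 : ℝ≥0∞) * ENNReal.ofReal (c / 4) = ENNReal.ofReal c := by
    rw [show (4 : ℝ≥0∞) = ENNReal.ofReal 4 by simp, ← ENNReal.ofReal_mul (by norm_num)]
    congr 1; ring
  rw [h4] at hsplit
  -- `ofReal (4c) = ofReal c + 3 V`
  have h3V : 3 * siegelVolume F = ENNReal.ofReal (3 * c) := by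
    have hsub : ENNReal.ofReal (4 * c) - ENNReal.ofReal c = 3 * siegelVolume F :=
      ENNReal.sub_eq_of_eq_add_rev ENNReal.ofReal_ne_top (by rw [hsplit])
    rw [← hsub, ← ENNReal.ofReal_sub _ hcpos]
    congr 1; ring
  have h3 : (3 : ℝ≥0∞) * siegelVolume F = 3 * ENNReal.ofReal c := by
    rw [h3V, show (3 : ℝ≥0∞) = ENNReal.ofReal 3 by simp, ← ENNReal.ofReal_mul (by norm_num)]
  exact (ENNReal.mul_right_inj (by norm_num) (by simp)).1 h3

end Final

end Literature.NumberTheory.ModularForms.Sp4Covolume
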